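import Mathlib.Algebra.Order.Archimedean.Real.Basic
import Literature.AnabelianGeometry.EtaleTheta.Discharge.Sec3Cor38CriterionLine
import Literature.AlgebraicGeometry.Frobenioids.PerfectionProofs
import HarnessLib

/-!
# [EtTh] Corollary 3.8 (i) sub-DAG — row C38-L05 PROVED modulo three printed properties of the Def. 3.3/3.6 (i)
# data: the intrinsic criterion for base-field-theoretic pre-steps

Mochizuki, *The étale theta function …*, Publ. RIMS **45** (2009), Cor. 3.8, proof PDF p.81 l.20–27
[cite: MochizukiEtTh2009, Cor 3.8 p.81]:

> "Now observe [cf. Proposition 3.4, (ii); the equivalences of categories of [Mzk17], Definition 1.3, (iii), (d),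
> determined by the operation of taking the zero divisor of a co-angular pre-step] that a pre-step of `C_i` is
> base-field-theoretic if and only if its image `A → B` in `C_i^pf` may be written as a [filtered] projective limit
> in the category `(C_i^pf)^coa-pre_B` … of pre-steps `A' → B` that are abstractly equivalent [cf. §0] to an
> endomorphism that belongs to '`O^▷(−)`'."

abc-iut cell, layer L2, seat abc-iut-w5-d124; LAST companion of `TemperedFrobenioidCor38Sub.lean` (p414329,
plan/L2/SUBDAG-EtTh-Cor38.md): row **C38-L05** = `TemperedFrobenioid.BsFldPreStepLimitCriterion C P` for THE
perfection `P := PreFrobenioidData.perfection hF` (L1, [FrdI] Prop. 3.2).  Parts (a)–(c) (`Sec3Cor38CriterionSlice`,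
`…OTri`) reduced the criterion to monoid theory: `IsLimitOfOTriLike P (toPf φ)` ⟺ `((φ^*)⁻¹ Div φ)^{1/1}` is the
supremum in `(Φ(B_D)^pf, ∣)` of a nonempty directed family of roots of divisors of rational functions with effective
divisor (`divOPf`).  This file does part (d) and assembles:

* `isBaseFieldTheoreticDiv_iff_isLUB_divOPf` — for `x ∈ Φ(W)`: `x ∈ Φ^{bs-fld}(W)` iff `x^{1/1}` is such a supremum;
* **`bsFldPreStepLimitCriterion_of`** — `C.BsFldPreStepLimitCriterion (PreFrobenioidData.perfection hF)`.

HYPOTHESES (binders; each a printed property of the data of Def. 3.3 (iii) / Def. 3.6 (i) that the typed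
`RealifiedDivisorMonoids` (abc-iut-L2-t3) does not record — rows G-w5d124-1/2/3 of the cell's plan/GAP-LEDGER.md):
* `hP34Λ` — Prop. 3.4 (ii) at monoid type `Λ` ("`O_L^▷ ⥲ B₀ ×_{Φ₀^gp} Φ₀`", p.74; Def. 3.6 (i) p.76): an element of
  `B₀^Λ(Y)` whose divisor is effective lies in `F₀^Λ(Y)` (the typed `DivisorMonoids.Prop34` covers `B₀` only);
* `hNZ` — Def. 3.6 (ii)(b), bracketed consequence, p.77 verbatim: "for every `A ∈ Ob(D)`, the image of the
  homomorphism `F(A) → (Φ^{bs-fld})^gp(A)` contains a nonzero element of `Φ^{bs-fld}(A)`";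
* `hSup` — the base-field-theoretic divisors (in `Φ(A)^pf`) of an element of `Φ(A)^pf` bounding a nonempty family of
  them contain one bounding the family: `Φ(A)^pf ⊆ Φ^{ℝ-log}(A) = Φ₀(Y_A)^rlf` group-saturated (Lemma 3.5, Rmk. 3.6.4),
  divisibility there is the prime-by-prime order of the realification ([FrdI] Def. 2.4 (i)(c)) and `ℝ·Φ₀^cnst(Y) =
  ℝ·div(ϖ)` (Prop. 3.4 (ii)), so these divisors form a closed interval `[0, min_𝔭 m_𝔭/c_𝔭]` of the line.
Without them the row is NOT derivable over the typed structure (abc-iut STATUS 2026-08-26 03:3xZ, seat w5-d124: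
toy data with `Φ(A) = ℕ³`, `ℝ·Φ₀^cnst ∋` a non-comparable element, resp. `ℝ·Φ₀^cnst` merely root-closed).
HONEST FRAMING: refereed pre-IUT material; nothing here bears on [IUTchIII] Cor. 3.12; typed ≠ proved for the rest.
-/

namespace Literature.AnabelianGeometry.EtaleTheta

open CategoryTheory Opposite Limits Literature.AlgebraicGeometry.Frobenioids

universe u₀ v₀ u v w

variable {D₀ : Type u₀} [Category.{v₀} D₀] {V : FrdIMonoidStub.{w}}
  {T : RealifiedDivisorMonoids (D₀ := D₀) V} {D : Type u} [Category.{v} D] {VD : FrdICatStub.{u, v, w} D}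

namespace TemperedFrobenioid

variable {C : TemperedFrobenioid T D VD}

/-! ### §1 Line coordinates: powers, and the rational-density step -/

/-- An additive coordinate vanishes at `1` and is `ℕ`-linear on powers. [cite: MochizukiFrdI2008, §0 p.10] -/
theorem lineCoord_pow {L : Type*} [CommMonoid L] {c : L → ℝ} (hadd : ∀ a b, c (a * b) = c a + c b) (l : L)
    (n : ℕ) : c (l ^ n) = n * c l := by
  induction n with
  | zero =>
    have h := hadd 1 1
    rw [mul_one] at h
    rw [pow_zero, Nat.cast_zero, zero_mul]
    linarith
  | succ n ih => rw [pow_succ, hadd, ih]; push_cast; ring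

/-- Powers of base-field-theoretic elements, as elements of the submonoid `Φ^{bs-fld}(A)`. (bookkeeping)
[cite: MochizukiEtTh2009, Def 3.6 p.77] -/
theorem bsFld_mk_pow {A : Dᵒᵖ} (l : C.Φ.carrier A) (hl : C.IsBaseFieldTheoreticDiv l) (n : ℕ)
    (hn : C.IsBaseFieldTheoreticDiv (l ^ n)) :
    (⟨((l ^ n : C.Φ.carrier A) : C.ΦRlog.obj A), hn⟩ : C.bsFld.carrier A) = ⟨(l : C.ΦRlog.obj A), hl⟩ ^ n :=
  Subtype.ext (by rw [SubmonoidClass.coe_pow, SubmonoidClass.coe_pow])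

/-- **Rational density on the line** (the step of part (d) where print's "[filtered] projective limit" is needed):
if `x ∈ Φ^{bs-fld}(W)` and a root `y = l^{1/N}` of a base-field-theoretic `l` divides `x^{1/1}` STRICTLY, then some
root `Z₀^{p/q}` of a nontrivial divisor `Z₀ = Div_B(u)` of a rational function divides `x^{1/1}` but not `y`
(`p/q` a rational number in the interval `(coord y, coord x]` of line coordinates). [cite: MochizukiEtTh2009, Cor 3.8 p.81] -/
theorem exists_divOPf_dvd_not_dvd (hF : PreFrobenioid.IsFrobenioid C.toElem) {W : D}
    {Z₀ : C.Φ.carrier (op W)} (hZ₀ : Z₀ ∈ C.divO W) (hZ₀b : C.IsBaseFieldTheoreticDiv Z₀) (hZ₀1 : Z₀ ≠ 1)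
    {x : C.Φ.carrier (op W)} (hx : C.IsBaseFieldTheoreticDiv x) {l : C.Φ.carrier (op W)}
    (hl : C.IsBaseFieldTheoreticDiv l) {N : ℕ+} (hyx : Perfection.mk l N ∣ Perfection.of _ x)
    (hxy : ¬ Perfection.of _ x ∣ Perfection.mk l N) :
    ∃ s ∈ C.divOPf W, s ∣ Perfection.of _ x ∧ ¬ s ∣ Perfection.mk l N := by
  obtain ⟨c, hadd, hinj, hdvd, hnn⟩ := exists_lineCoord_bsFld (C := C) (op W)
  -- coordinates: `t = c x`, `cl = c l`, `s₀ = c Z₀ > 0`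
  set t : ℝ := c ⟨(x : C.ΦRlog.obj (op W)), hx⟩ with ht
  set cl : ℝ := c ⟨(l : C.ΦRlog.obj (op W)), hl⟩ with hcl
  set s₀ : ℝ := c ⟨(Z₀ : C.ΦRlog.obj (op W)), hZ₀b⟩ with hs₀
  have hc1 : c 1 = 0 := by have h := hadd 1 1; rw [mul_one] at h; linarith
  have hs₀pos : 0 < s₀ := by
    rcases (hnn ⟨(Z₀ : C.ΦRlog.obj (op W)), hZ₀b⟩).lt_or_eq with h | h
    · exact h
    · exfalso; apply hZ₀1
      have : (⟨(Z₀ : C.ΦRlog.obj (op W)), hZ₀b⟩ : C.bsFld.carrier (op W)) = 1 := hinj (by rw [hc1]; exact h.symm)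
      exact Subtype.ext (congrArg Subtype.val this :)
  -- the two divisibilities in coordinates: `cl ≤ N t` and `¬ N t ≤ cl`
  have hxN : C.IsBaseFieldTheoreticDiv (x ^ (N : ℕ)) := isBaseFieldTheoreticDiv_pow hx _
  have h1 : l ^ (((1 : ℕ+) : ℕ)) ∣ x ^ (N : ℕ) := (mk_dvd_mk_iff hF l x N 1).mp hyx
  rw [PNat.one_coe, pow_one] at h1
  have h1c : cl ≤ (N : ℝ) * t := by
    have := (hdvd _ _).mp ((dvd_iff_bsFld_dvd hl hxN).mp h1)
    rwa [bsFld_mk_pow x hx (N : ℕ) hxN, lineCoord_pow hadd] at this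
  have h2c : ¬ (N : ℝ) * t ≤ cl := by
    intro hle
    apply hxy
    have h2 : x ^ (N : ℕ) ∣ l ^ (((1 : ℕ+) : ℕ)) := by
      rw [PNat.one_coe, pow_one]
      refine (dvd_iff_bsFld_dvd hxN hl).mpr ((hdvd _ _).mpr ?_)
      rwa [bsFld_mk_pow x hx (N : ℕ) hxN, lineCoord_pow hadd]
    exact (mk_dvd_mk_iff hF x l 1 N).mpr h2
  have hδ : 0 < (N : ℝ) * t - cl := by have := not_le.mp h2c; linarith
  -- choose `q ≥ 1` with `q · (N t − cl) ≥ N s₀`, then `p := ⌊q t / s₀⌋`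
  obtain ⟨q₀, hq₀⟩ := exists_nat_ge ((N : ℝ) * s₀ / ((N : ℝ) * t - cl))
  have hq₀' : (N : ℝ) * s₀ ≤ q₀ * ((N : ℝ) * t - cl) := (div_le_iff₀ hδ).mp hq₀
  have hqδ : (N : ℝ) * s₀ ≤ ((q₀ + 1 : ℕ) : ℝ) * ((N : ℝ) * t - cl) := by
    push_cast; nlinarith
  have htnn : 0 ≤ t := hnn _
  set q : ℕ := q₀ + 1 with hq
  set p : ℕ := Nat.floor ((q : ℝ) * t / s₀) with hp
  have hp₁ : (p : ℝ) ≤ (q : ℝ) * t / s₀ :=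
    Nat.floor_le (div_nonneg (mul_nonneg (Nat.cast_nonneg q) htnn) hs₀pos.le)
  have hp₂ : (q : ℝ) * t / s₀ < p + 1 := Nat.lt_floor_add_one _
  have hA : (p : ℝ) * s₀ ≤ (q : ℝ) * t := (le_div_iff₀ hs₀pos).mp hp₁
  have hB : (q : ℝ) * cl < (N : ℝ) * ((p : ℝ) * s₀) := by
    have h2 : (q : ℝ) * t < ((p : ℝ) + 1) * s₀ := (div_lt_iff₀ hs₀pos).mp hp₂
    have hNpos : (0 : ℝ) < (N : ℝ) := by exact_mod_cast N.pos
    nlinarith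
  -- the element `s := (Z₀^p)^{1/q}`
  let q' : ℕ+ := ⟨q, Nat.succ_pos q₀⟩
  have hZp : C.IsBaseFieldTheoreticDiv (Z₀ ^ p) := isBaseFieldTheoreticDiv_pow hZ₀b _
  refine ⟨Perfection.mk (Z₀ ^ p) q', ⟨Z₀ ^ p, q', pow_mem_divO hZ₀ p, rfl⟩, ?_, ?_⟩
  · -- `s ∣ x^{1/1}` ⟺ `p s₀ ≤ q t`
    refine (mk_dvd_mk_iff hF (Z₀ ^ p) x q' 1).mpr ?_
    show (Z₀ ^ p) ^ (((1 : ℕ+) : ℕ)) ∣ x ^ (q : ℕ)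
    rw [PNat.one_coe, pow_one]
    have hxq : C.IsBaseFieldTheoreticDiv (x ^ q) := isBaseFieldTheoreticDiv_pow hx _
    refine (dvd_iff_bsFld_dvd hZp hxq).mpr ((hdvd _ _).mpr ?_)
    rw [bsFld_mk_pow Z₀ hZ₀b p hZp, bsFld_mk_pow x hx q hxq, lineCoord_pow hadd, lineCoord_pow hadd]
    exact hA
  · -- `¬ s ∣ l^{1/N}` ⟺ `¬ N p s₀ ≤ q cl`
    intro hs
    have h3 : (Z₀ ^ p) ^ (N : ℕ) ∣ l ^ (q : ℕ) := (mk_dvd_mk_iff hF (Z₀ ^ p) l q' N).mp hs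
    rw [← pow_mul] at h3
    have hZpN : C.IsBaseFieldTheoreticDiv (Z₀ ^ (p * (N : ℕ))) := isBaseFieldTheoreticDiv_pow hZ₀b _
    have hlq : C.IsBaseFieldTheoreticDiv (l ^ q) := isBaseFieldTheoreticDiv_pow hl _
    have h3c := (hdvd _ _).mp ((dvd_iff_bsFld_dvd hZpN hlq).mp h3)
    rw [bsFld_mk_pow Z₀ hZ₀b _ hZpN, bsFld_mk_pow l hl q hlq, lineCoord_pow hadd, lineCoord_pow hadd] at h3c
    push_cast at h3c
    nlinarith

/-! ### §2 Part (d): base-field-theoretic ⟺ supremum of O^▷-divisors -/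

/-- A nontrivial base-field-theoretic divisor of a rational function at every object, from the printed consequence
of Def. 3.6 (ii)(b) (hypothesis `hNZ`). [cite: MochizukiEtTh2009, Def 3.6 p.77] -/
theorem exists_divO_ne_one
    (hNZ : ∀ A : Dᵒᵖ, ∃ u : (T.BΛ.obj (C.baseOp A) : Type w) × Algebra.GrothendieckGroup (C.Φ.carrier A),
      u ∈ C.cnstFn A ∧ ∃ Z : C.Φ.carrier A, Z ≠ 1 ∧ u.2 = Algebra.GrothendieckGroup.of Z)
    (W : D) : ∃ Z₀ : C.Φ.carrier (op W), Z₀ ∈ C.divO W ∧ C.IsBaseFieldTheoreticDiv Z₀ ∧ Z₀ ≠ 1 := by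
  obtain ⟨u, hu, Z, hZ1, hZ⟩ := hNZ (op W)
  exact ⟨Z, ⟨⟨u, C.cnstFn_le_ratFn _ hu⟩, hZ⟩, isBaseFieldTheoreticDiv_of_cnstFn hu hZ, hZ1⟩

/-- **Part (d)** of row C38-L05: for `x ∈ Φ(W)`, `x` is base-field-theoretic iff `x^{1/1} ∈ Φ(W)^pf` is the supremum,
for divisibility, of a nonempty directed family of elements of `divOPf C W` dividing it — GIVEN `hP34Λ`, `hNZ`,
`hSup` (module docstring). (⇐): the family lies on the line (`hP34Λ`), `hSup` provides a base-field-theoretic `y`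
between the family and `x^{1/1}`, the supremum property and antisymmetry give `x^{1/1} = y`. (⇒): take ALL
O^▷-divisors below `x^{1/1}` (directed: the line is totally ordered); for an upper bound `z`, `hSup` gives a
base-field-theoretic `y ∣ z` above the family, and `x^{1/1} ∣ y` by rational density (`exists_divOPf_dvd_not_dvd`).
[cite: MochizukiEtTh2009, Cor 3.8 p.81] -/
theorem isBaseFieldTheoreticDiv_iff_isLUB_divOPf (hF : PreFrobenioid.IsFrobenioid C.toElem)
    (hP34Λ : ∀ (Y : D₀ᵒᵖ) (b : T.BΛ.obj Y) (r : T.ΦR.obj Y),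
      T.divΛ Y b = Algebra.GrothendieckGroup.of r → b ∈ T.FΛ Y)
    (hNZ : ∀ A : Dᵒᵖ, ∃ u : (T.BΛ.obj (C.baseOp A) : Type w) × Algebra.GrothendieckGroup (C.Φ.carrier A),
      u ∈ C.cnstFn A ∧ ∃ Z : C.Φ.carrier A, Z ≠ 1 ∧ u.2 = Algebra.GrothendieckGroup.of Z)
    (hSup : ∀ (W : D) (m : Perfection (C.divisorMonoid.obj (op W))) (U : Set (Perfection (C.divisorMonoid.obj (op W)))),
      U ⊆ C.bsFldPf W → U.Nonempty → (∀ u ∈ U, u ∣ m) → ∃ y ∈ C.bsFldPf W, (∀ u ∈ U, u ∣ y) ∧ y ∣ m)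
    {W : D} (x : C.divisorMonoid.obj (op W)) :
    C.IsBaseFieldTheoreticDiv x ↔
      ∃ S : Set (Perfection (C.divisorMonoid.obj (op W))), S ⊆ C.divOPf W ∧ S.Nonempty ∧
        DirectedOn (fun a b => a ∣ b) S ∧ (∀ s ∈ S, s ∣ Perfection.of _ x) ∧
        ∀ z, (∀ s ∈ S, s ∣ z) → Perfection.of _ x ∣ z := by
  constructor
  · intro hx
    obtain ⟨Z₀, hZ₀, hZ₀b, hZ₀1⟩ := exists_divO_ne_one hNZ W
    let S : Set (Perfection (C.divisorMonoid.obj (op W))) := {s | s ∈ C.divOPf W ∧ s ∣ Perfection.of _ x}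
    have hSne : S.Nonempty :=
      ⟨Perfection.mk 1 1, mk_one_mem_divOPf (one_mem_divO W), by rw [Perfection.mk_one]; exact one_dvd _⟩
    refine ⟨S, fun s hs => hs.1, hSne, ?_, fun s hs => hs.2, ?_⟩
    · intro s hs s' hs'
      rcases bsFldPf_dvd_total hF (divOPf_subset_bsFldPf hP34Λ W hs.1) (divOPf_subset_bsFldPf hP34Λ W hs'.1)
        with h | h
      · exact ⟨s', hs', h, dvd_rfl⟩
      · exact ⟨s, hs, dvd_rfl, h⟩
    · intro z hz
      obtain ⟨y, hy, hSy, hyz⟩ := hSup W z S (fun s hs => divOPf_subset_bsFldPf hP34Λ W hs.1) hSne hz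
      rcases bsFldPf_dvd_total hF ((of_mem_bsFldPf_iff x).2 hx) hy with h | h
      · exact h.trans hyz
      · -- `y` strictly below `x^{1/1}` is impossible: an O^▷-divisor separates them
        by_contra hxz
        have hxy : ¬ Perfection.of _ x ∣ y := fun h' => hxz (h'.trans hyz)
        obtain ⟨l, N, hl, rfl⟩ := hy
        obtain ⟨s, hs, hsx, hsy⟩ := exists_divOPf_dvd_not_dvd hF hZ₀ hZ₀b hZ₀1 hx hl h hxy
        exact hsy (hSy s ⟨hs, hsx⟩)
  · rintro ⟨S, hS, hne, -, hbd, hlub⟩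
    obtain ⟨y, hy, hSy, hyx⟩ := hSup W _ S (hS.trans (divOPf_subset_bsFldPf hP34Λ W)) hne hbd
    have hxy : Perfection.of _ x ∣ y := hlub y hSy
    rw [← of_mem_bsFldPf_iff, perfection_dvd_antisymm hF hxy hyx]
    exact hy

/-! ### §3 Assembly with parts (a)–(c): row C38-L05 -/

/-- `Φ^{bs-fld}` is stable under the pull-back maps of `Φ` (a subfunctor, Def. 3.6 (ii)(a)) — for an ARBITRARY
monoid vocabulary `V` (the tree's `isBaseFieldTheoreticDiv_pull` of `Sec3CuspidalPreSteps` is the `treeMonoidVocab`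
instance). [cite: MochizukiEtTh2009, Def 3.6 p.77] -/
theorem pull_isBaseFieldTheoreticDiv {W W' : D} (g : W' ⟶ W) {a : C.divisorMonoid.obj (op W)}
    (ha : C.IsBaseFieldTheoreticDiv a) : C.IsBaseFieldTheoreticDiv (pull C.divisorMonoid g a) :=
  C.bsFld.map_mem g.op _ ha

/-- A pre-step `φ` is base-field-theoretic iff `(φ^*)⁻¹ Div φ ∈ Φ^{bs-fld}(Base B)` (pull back along the
base-isomorphism `Base φ` and its inverse). [cite: MochizukiEtTh2009, Def 3.6 p.78] -/
theorem isBaseFieldTheoretic_iff_invDiv {A B : C.category} (φ : A ⟶ B) (h : PreFrobenioid.IsBaseIso C.toElem φ) :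
    C.IsBaseFieldTheoretic φ ↔ C.IsBaseFieldTheoreticDiv (PreFrobenioid.invDiv C.toElem φ h) := by
  haveI : IsIso (PreFrobenioid.Base C.toElem φ) := h
  constructor
  · intro hφ
    exact pull_isBaseFieldTheoreticDiv _ hφ
  · intro hφ
    have := pull_isBaseFieldTheoreticDiv (PreFrobenioid.Base C.toElem φ) hφ
    rw [PreFrobenioid.pull_invDiv] at this
    exact this

/-- `δ` of the image of a pre-step `φ` of `C` in `C^pf`: `((toPf φ)^*)⁻¹ Div (toPf φ) = ((φ^*)⁻¹ Div φ)^{1/1}`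
(Prop. 3.2 (i): `Base(toPf φ) = Base φ`, `Div(toPf φ) = Div(φ)^{1/1}`). [cite: MochizukiFrdI2008, Prop. 3.2 (i) p.58] -/
theorem sliceDiv_toPf (hF : PreFrobenioid.IsFrobenioid C.toElem) {A B : C.category} (φ : A ⟶ B)
    (h : PreFrobenioid.IsBaseIso C.toElem φ)
    (hψ : (PreFrobenioidData.perfection hF).ops.IsCoAngularPreStep ((PreFrobenioidData.perfection hF).toPf.map φ)) :
    Cor38Criterion.sliceDiv hF ⟨Over.mk ((PreFrobenioidData.perfection hF).toPf.map φ), hψ⟩ =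
      Perfection.of _ (PreFrobenioid.invDiv C.toElem φ h) := by
  haveI : IsIso (PreFrobenioid.Base C.toElem φ) := h
  rw [Cor38Criterion.sliceDiv_mk]
  apply PreFrobenioid.Perfection.invDiv_eq_of_pull_eq
  have hb : PreFrobenioid.Base (PreFrobenioidData.perfection hF).ops.toFunctor
      ((PreFrobenioidData.perfection hF).toPf.map φ) = PreFrobenioid.Base C.toElem φ :=
    PreFrobenioid.Perfection.baseMap_toPf (hF := hF) φ
  have hd : PreFrobenioid.Div (PreFrobenioidData.perfection hF).ops.toFunctor
      ((PreFrobenioidData.perfection hF).toPf.map φ) = Perfection.mk (PreFrobenioid.Div C.toElem φ) 1 :=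
    PreFrobenioid.Perfection.div_toPf (hF := hF) φ
  rw [hb, hd, Perfection.of_apply]
  change Perfection.map (pull C.divisorMonoid (PreFrobenioid.Base C.toElem φ)) _ = _
  rw [Perfection.map_mk, PreFrobenioid.pull_invDiv]

variable (C) in
/-- **Row C38-L05 of the [EtTh] Cor. 3.8 sub-DAG** (proof of Cor. 3.8, PDF p.81 l.20–27): for THE perfection of the
Frobenioid of a tempered Frobenioid, a pre-step is base-field-theoretic if and only if its image in `C^pf` is a
cofiltered limit, in `(C^pf)^coa-pre_B`, of pre-steps abstractly equivalent to an element of some `O^▷(−)` — GIVEN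
the printed properties `hP34Λ` (Prop. 3.4 (ii) at monoid type `Λ`), `hNZ` (Def. 3.6 (ii)(b), bracketed consequence)
and `hSup` (suprema along `ℝ·Φ₀^cnst` in the realification, [FrdI] Def. 2.4 (i) / Lemma 3.5) of the data of
Def. 3.3/3.6 (i), which the typed `RealifiedDivisorMonoids` does not record.  With this row the cell's table for
Cor. 3.8 (i)/(ii) has no open row (13 rows landed earlier, p413893–p417120). [cite: MochizukiEtTh2009, Cor 3.8 p.81] -/
theorem bsFldPreStepLimitCriterion_of (hF : PreFrobenioid.IsFrobenioid C.toElem)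
    (hP34Λ : ∀ (Y : D₀ᵒᵖ) (b : T.BΛ.obj Y) (r : T.ΦR.obj Y),
      T.divΛ Y b = Algebra.GrothendieckGroup.of r → b ∈ T.FΛ Y)
    (hNZ : ∀ A : Dᵒᵖ, ∃ u : (T.BΛ.obj (C.baseOp A) : Type w) × Algebra.GrothendieckGroup (C.Φ.carrier A),
      u ∈ C.cnstFn A ∧ ∃ Z : C.Φ.carrier A, Z ≠ 1 ∧ u.2 = Algebra.GrothendieckGroup.of Z)
    (hSup : ∀ (W : D) (m : Perfection (C.divisorMonoid.obj (op W))) (U : Set (Perfection (C.divisorMonoid.obj (op W)))),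
      U ⊆ C.bsFldPf W → U.Nonempty → (∀ u ∈ U, u ∣ m) → ∃ y ∈ C.bsFldPf W, (∀ u ∈ U, u ∣ y) ∧ y ∣ m) :
    C.BsFldPreStepLimitCriterion (PreFrobenioidData.perfection hF) := by
  intro A B φ hφ
  have hψ : (PreFrobenioidData.perfection hF).ops.IsCoAngularPreStep ((PreFrobenioidData.perfection hF).toPf.map φ) :=
    Cor38Criterion.isCoAngularPreStep_of_isPreStep (PreFrobenioid.Perfection.preservesMor_isPreStep hF φ hφ)
  rw [Cor38Criterion.isLimitOfOTriLike_iff_isLUB_divOPf _ hψ, sliceDiv_toPf hF φ hφ.2 hψ,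
    isBaseFieldTheoretic_iff_invDiv φ hφ.2]
  exact isBaseFieldTheoreticDiv_iff_isLUB_divOPf hF hP34Λ hNZ hSup _

end TemperedFrobenioid

end Literature.AnabelianGeometry.EtaleTheta
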